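import Mathlib
import Summits.KontsevichZagierPeriods.Zeta5Search.BrickDigitSide
import Summits.KontsevichZagierPeriods.Zeta5Search.BrickOffDigitSide
import Summits.KontsevichZagierPeriods.Zeta5Search.BrickPartialFractions

/-!
# BrickTheoremSixS — zi-p2's THEOREM 6, congruence (S) for the cells `s ≥ 1`, AS A KERNEL THEOREM:
`p^{2τ_s}·x_s(np) ≡ p^{τ_s}·x_s(n) (mod p³)` for every prime `p ≥ 5`, `A` even with `A ≥ 5`, `2 ≤ 2B ≤ A`,
every `n < p²` and every `1 ≤ s ≤ A − 1` (cell zeta5-irr)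

HONEST FRAMING: systematic search; no irrationality claim unless certified. INSTRUMENT theorem of the ζ(5)
census cell zeta5-irr (HOME `run/shared/lean/pub/zeta5-irr/`; memo `zi-p2/probes/B8/thm6/THEOREM6.md` §1
«**THEOREM 6.** Let `A ≥ 6` be even, `B ≥ 1`, `A > 2B`, `p ≥ 5` prime and `p ≤ n < p²`. Then for `s = 0` and for every
odd `s` with `3 ≤ s ≤ A−1`: `β_s(np) ≡ β_s(n) (mod p³)`, i.e. `p^{2τ_s}x_s(np) ≡ p^{τ_s}x_s(n) (mod p³ℤ_(p))`»,
`x_s(n) = Σ_{K=0}^{n}c_{K,s}(n)`, `τ_s = A−1−s`; zi-ref R6.6 PASS as THEOREM (certificate kit j261827)). Nothing here is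
about ζ(5); no irrationality content; filing moves no rung: THEOREM 6 is a normalised Dwork-type congruence for the
coefficients of the Ball/Rivoal linear forms — structure of the top `p`-layers, not size (FINDINGS-DENOM §0:
0 nats/n). This file puts its `s ≥ 1` half in the kernel for EVERY `s ≤ A−1` (even `s` included, where zi-p2 notes
`x_s = 0`) and every `n < p²` (for `n < p` the statement is `p^{τ_s}`·(THEOREM 2 (iii)), weaker than the memo's
level-0 form); the constant term `s = 0` (harmonic cells) is NOT here. Filed by the engine seat zi-eng (g8): the sum
`p^{2τ}x_s(np) − p^{τ}x_s(n)` splits into the digit differences `Σ_{j≤n} D_j^{(s)}` (`BrickDigitSide.sum_digitD_le`: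
`≡ 0 mod p³`) and the off-digit terms `p^{2τ}c_{K,s}(np)`, `p ∤ K` (`BrickOffDigitSide.offDigit_term_le`: each of
valuation `≥ A − 2 ≥ 3`).

## The statement

For a prime `p ≥ 5`, `A` even with `A ≥ 5`, `1 ≤ B`, `2B ≤ A`, `n < p²`, `s + 1 ≤ A`, `τ = A − 1 − s`, and
`xCoeff A B 1 m s = x_s(m) = Σ_{K ≤ m} c_{K,s}(m)` (`BrickPartialFractions`):

**`v(p^{2τ}·xCoeff A B 1 (np) s − p^{τ}·xCoeff A B 1 n s) ≤ exp(−3)`** (`theoremSix_S`).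
-/

namespace Summit.KontsevichZagierPeriods.Zeta5Search.BrickTheoremSixS

open Finset Nat WithZero
open Summit.KontsevichZagierPeriods.Zeta5Search.BrickLaurent (cell)
open Summit.KontsevichZagierPeriods.Zeta5Search.BrickPartialFractions (xCoeff)
open Summit.KontsevichZagierPeriods.Zeta5Search.BrickDigitStepD (digitD)
open Summit.KontsevichZagierPeriods.Zeta5Search.BrickDigitSide (sum_digitD_le)
open Summit.KontsevichZagierPeriods.Zeta5Search.BrickOffDigitSide (offDigit_term_le)

noncomputable section

variable {p : ℕ} [Fact p.Prime]

/-- The multiples of `p` in `[0, np]` are exactly `jp`, `j ≤ n`: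
`Σ_{K ≤ np, p ∣ K} F(K) = Σ_{j ≤ n} F(jp)`. -/
theorem sum_filter_dvd_eq (F : ℕ → ℚ) (n : ℕ) :
    ∑ K ∈ (range (n * p + 1)).filter (fun K => p ∣ K), F K = ∑ j ∈ range (n + 1), F (j * p) := by
  have hp : p.Prime := Fact.out
  have hp0 : 0 < p := hp.pos
  have himg : (range (n * p + 1)).filter (fun K => p ∣ K) = (range (n + 1)).image (fun j => j * p) := by
    ext K
    simp only [mem_filter, mem_range, mem_image]
    constructor
    · rintro ⟨hK, ⟨q, rfl⟩⟩
      refine ⟨q, ?_, by ring⟩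
      by_contra h
      have : (n + 1) * p ≤ p * q := by rw [mul_comm]; exact Nat.mul_le_mul_left p (by omega)
      nlinarith
    · rintro ⟨j, hj, rfl⟩
      exact ⟨by nlinarith, ⟨j, by ring⟩⟩
  rw [himg, sum_image fun j₁ _ j₂ _ h => Nat.eq_of_mul_eq_mul_right hp0 h]

/-- **THEOREM 6 (S), cells `s ≥ 1`**: `v_p(p^{2τ_s}·x_s(np) − p^{τ_s}·x_s(n)) ≥ 3`. -/
theorem theoremSix_S (h3 : 3 < p) {A B n s : ℕ} (hA : Even A) (hA5 : 5 ≤ A) (hAB : 2 * B ≤ A) (hB : 1 ≤ B)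
    (hn : n < p ^ 2) (hs : s + 1 ≤ A) :
    Rat.padicValuation p ((p : ℚ) ^ (2 * (A - 1 - s)) * xCoeff A B 1 (n * p) s -
      (p : ℚ) ^ (A - 1 - s) * xCoeff A B 1 n s) ≤ exp (-3) := by
  have hp : p.Prime := Fact.out
  have hp2 : p ≠ 2 := by omega
  set τ := A - 1 - s with hτ
  -- split the level-`np` sum into digits and off-digits
  have hsplit : (p : ℚ) ^ (2 * τ) * xCoeff A B 1 (n * p) s - (p : ℚ) ^ τ * xCoeff A B 1 n s =
      ∑ j ∈ range (n + 1), digitD A B p 1 n j s +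
        ∑ K ∈ (range (n * p + 1)).filter (fun K => ¬ p ∣ K), (p : ℚ) ^ (2 * τ) * cell A B 1 (n * p) K s := by
    unfold xCoeff
    rw [Finset.mul_sum, Finset.mul_sum, ← sum_filter_add_sum_filter_not (range (n * p + 1)) (fun K => p ∣ K),
      sum_filter_dvd_eq, add_sub_right_comm, ← Finset.sum_sub_distrib]
    congr 1
    refine Finset.sum_congr rfl fun j _ => ?_
    rw [digitD, hτ, one_mul, two_mul, pow_add]
    ring
  rw [hsplit]
  refine (Valuation.map_add _ _ _).trans (max_le (sum_digitD_le h3 hA hAB hB hn hs) ?_)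
  refine Valuation.map_sum_le _ fun K hK => ?_
  have hK' := mem_range.1 (mem_filter.1 hK).1
  have hndvd := (mem_filter.1 hK).2
  have hKlt : K < n * p := by
    rcases Nat.lt_or_ge K (n * p) with h | h
    · exact h
    · exfalso; exact hndvd ⟨n, by rw [mul_comm]; omega⟩
  have hjn : K / p < n := (Nat.div_lt_iff_lt_mul hp.pos).2 hKlt
  have hi1 : 1 ≤ K % p := by
    by_contra h
    exact hndvd (Nat.dvd_of_mod_eq_zero (by omega))
  have hip : K % p < p := Nat.mod_lt _ hp.pos
  have h := offDigit_term_le (p := p) hp2 (s := s) hAB hn hjn hi1 hip hs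
  rw [Nat.div_add_mod'] at h
  exact h.trans (exp_le_exp.2 (by omega))

end

end Summit.KontsevichZagierPeriods.Zeta5Search.BrickTheoremSixS
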